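import Literature.RingTheory.Etale.SplitByPoints
import HarnessLib

/-!
# `κ ⊗_ℤ 𝓞_K ≅ κ^{[K:ℚ]}` — the embeddings of a number field split its ring of integers over a residue field with enough points

Topic: `Literature/NumberTheory/NumberFields`.  For a number field `K`, a field `κ` (in applications the residue field
`κ(𝔓)` of a prime `𝔓 ∣ p` of a number field `L ⊇` all conjugates of `K`), and a family of PAIRWISE DISTINCT ring
homomorphisms `ψ i : 𝓞 K → κ` indexed by a set of cardinality `[K : ℚ]` (in applications `ψ_φ = (· mod 𝔓) ∘ φ|_{𝓞 K}` for the
embeddings `φ : K →+* L`, pairwise distinct modulo `𝔓` when `p ∤ disc K` — sibling file `UnramifiedPrimeEmbeddingsModP`;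
here the distinctness is the HYPOTHESIS `hψ`/`hinj`), the evaluation map
  `κ ⊗_ℤ 𝓞 K ⟶ ∏_i κ`, `x ⊗ a ↦ (x · ψ i (a))_i`
is an isomorphism of `κ`-algebras (`Literature.RingTheory.Etale.bijective_pi_baseChange_of_card_eq_finrank` at `A = ℤ`,
`B = 𝓞 K` free of rank `[K:ℚ]`, Mathlib `RingOfIntegers.rank`).  This is the «étale splitting»
`𝓞_K ⊗ 𝓞_{L,𝔓} ≅ ∏_φ 𝓞_{L,𝔓}` read on the special fibre — the eigen-decomposition along the embeddings used to read the
action of `𝓞_K` on cotangent spaces of reductions of CM abelian varieties ([Shimura1998] §13.2, under the proviso «`p`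
unramified in `K`»: `det[βᵢ^{φⱼ}]² = d(K)` is a `𝔓`-unit).  The residue field is kept ABSTRACT (`κ` any field receiving
`𝓞 L`), which is how consumers avoid the two `ℤ`-algebra structures on a quotient ring `𝓞 L ⧸ 𝔓`.  Theorems only.

References: G. Shimura, *Abelian Varieties with Complex Multiplication and Modular Functions* (1998), §13.2 pp. 130–131;
J. S. Milne, *Fields and Galois Theory*, Ch. 8 (étale algebras).  Cell hodgecm-mathlib, E2 background (P1-alg (ii)),
banked leaf toward the S2 height-one road; no floor change; HC_CM is proved only modulo the 7 printed citations until
rung 0 closes.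
-/

namespace Literature.NumberTheory.NumberFields

open TensorProduct NumberField

universe u v w

variable (K : Type u) [Field K] [NumberField K] {κ : Type w} [Field κ]

/-- **`κ ⊗_ℤ 𝓞_K → κ^ι` is bijective** for `[K:ℚ]` pairwise distinct ring homomorphisms `ψ i : 𝓞 K → κ` into a field:
the étale splitting of the ring of integers along a full set of residual embeddings.  (`𝓞 K` is free of rank `[K:ℚ]`
over `ℤ`, and a finite free algebra with enough rational points splits.) [cite: Shimura1998, §13.2 pp. 130–131]
[cite: MilneFT2022, Ch. 8 (étale algebras)] -/
theorem bijective_pi_tensor_ringOfIntegers {ι : Type*} [Fintype ι] (ψ : ι → (𝓞 K →+* κ))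
    (hψ : Function.Injective ψ) (hcard : Fintype.card ι = Module.finrank ℚ K) :
    Function.Bijective (AlgHom.pi (fun i : ι =>
      Algebra.TensorProduct.lift (AlgHom.id κ κ) (ψ i).toIntAlgHom (fun _ _ => Commute.all _ _)) :
      κ ⊗[ℤ] 𝓞 K →ₐ[κ] (ι → κ)) := by
  have hψ' : Function.Injective fun i : ι => (ψ i).toIntAlgHom := RingHom.toIntAlgHom_injective.comp hψ
  have hcard' : Fintype.card ι = Module.finrank ℤ (𝓞 K) := by rw [hcard, RingOfIntegers.rank]
  exact Literature.RingTheory.Etale.bijective_pi_baseChange_of_card_eq_finrank _ hψ' hcard'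

/-- **The étale splitting as an isomorphism of `κ`-algebras** `κ ⊗_ℤ 𝓞 K ≃ₐ[κ] κ^ι`, with its formula on pure tensors
`x ⊗ a ↦ (x · ψ i (a))_i` (existence statement; the map is `AlgEquiv.ofBijective` of the evaluation map).
[cite: Shimura1998, §13.2 pp. 130–131] [cite: MilneFT2022, Ch. 8 (étale algebras)] -/
theorem exists_algEquiv_pi_tensor_ringOfIntegers {ι : Type*} [Fintype ι] (ψ : ι → (𝓞 K →+* κ))
    (hψ : Function.Injective ψ) (hcard : Fintype.card ι = Module.finrank ℚ K) :
    ∃ e : κ ⊗[ℤ] 𝓞 K ≃ₐ[κ] (ι → κ), ∀ (x : κ) (a : 𝓞 K) (i : ι), e (x ⊗ₜ[ℤ] a) i = x * ψ i a := by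
  refine ⟨AlgEquiv.ofBijective _ (bijective_pi_tensor_ringOfIntegers K ψ hψ hcard), fun x a i => ?_⟩
  rw [AlgEquiv.ofBijective_apply, AlgHom.pi_apply, Algebra.TensorProduct.lift_tmul]
  rfl

/-- **Dimension count**: `dim_κ (κ ⊗_ℤ 𝓞 K) = [K : ℚ]`. [cite: Shimura1998, §13.2 pp. 130–131] -/
theorem finrank_tensor_ringOfIntegers : Module.finrank κ (κ ⊗[ℤ] 𝓞 K) = Module.finrank ℚ K := by
  rw [Module.finrank_baseChange, RingOfIntegers.rank]

variable (L : Type v) [Field L] [NumberField L]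

/-- **Along the embeddings `φ : K →+* L`, reduced through `r : 𝓞 L → κ`** (in applications `r = (· mod 𝔓)` onto the residue
field of a prime `𝔓 ∣ p`, `p ∤ disc K`, `L ⊇` all conjugates of `K`): if the reductions `r ∘ φ|_{𝓞 K}` are pairwise distinct
and `#(K →+* L) = [K:ℚ]`, then `κ ⊗_ℤ 𝓞 K ≃ₐ[κ] ∏_{φ : K →+* L} κ` with `x ⊗ a ↦ (x · r(φ a))_φ`.
[cite: Shimura1998, §13.2 pp. 130–131] [cite: MilneFT2022, Ch. 8 (étale algebras)] -/
theorem exists_algEquiv_pi_embeddings_of_injective (r : 𝓞 L →+* κ)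
    (hinj : Function.Injective fun φ : K →+* L => r.comp (RingOfIntegers.mapRingHom φ))
    (hcard : Fintype.card (K →+* L) = Module.finrank ℚ K) :
    ∃ e : κ ⊗[ℤ] 𝓞 K ≃ₐ[κ] ((K →+* L) → κ),
      ∀ (x : κ) (a : 𝓞 K) (φ : K →+* L), e (x ⊗ₜ[ℤ] a) φ = x * r (RingOfIntegers.mapRingHom φ a) :=
  exists_algEquiv_pi_tensor_ringOfIntegers K (fun φ : K →+* L => r.comp (RingOfIntegers.mapRingHom φ)) hinj hcard

end Literature.NumberTheory.NumberFields
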